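import Summits.BirchSwinnertonDyer.Rank1Residual.X2.GreenbergVatsalThm13GoodOrdinaryTateFree
import Summits.BirchSwinnertonDyer.Rank1Residual.X2.IsogenyPeriodRatio
import Summits.BirchSwinnertonDyer.Rank1Residual.X2.NonPrimitiveLambdaInvariantOfDatum
import HarnessLib

/-!
# GV Thm. (1.3) in the printed good-ordinary setting (A14), Tate-free AND period-free (cell
# `b2b-bsdres`, unit `b2b-bsdres-eisenstein-p2`, gen 28)

HONEST FRAMING (run/shared/lean/b2b/bsd-rank1-residual/, verbatim in every file): the goal of the
cell is to DELETE the COMBINATION-SHAPED residual classes of the Birch–Swinnerton-Dyer formula for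
ALL analytic-rank `≤ 1` elliptic curves over `ℚ` — "full BSD formula for every rank `≤ 1` curve in
class `C`" assembled STRICTLY from published theorems — so that the rank-`≤ 1` remainder becomes
exactly the CONSTRUCTION-SHAPED classes, which are TYPED (missing-input `Prop`s), NOT attempted.
This is not "finishing BSD". Research route; NO CLAIM BEYOND STATED CLASSES; nothing here changes
a label. Theorems only; no definition, no named fact.

WHAT. Gen 24's `GreenbergVatsalThm13GoodOrdinaryTateFree` derived A14
(`GreenbergVatsal2000.thm13_charIdeal_eq_of_gvPar`) from nine registered facts, one of them the
period record A180 (GV Cor. (3.8), binder `hP`, consumed once: `caseTwo_clause_goodOrdHalf`).  Gen 28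
proved that input for the quotient the chain builds (`X2/IsogenyPeriodRatio.exists_quot_realPeriodRat_eq_unit_mul`,
good-ordinary disjunct).  This file is the same ladder WITHOUT `hP` (bodies verbatim otherwise):
`caseTwo_clause_goodOrdHalf_periodFree`, `lambda_muAnal_goodOrd_of_gvPar_goodOrdHalf_periodFree`,
`thm13_charIdeal_eq_of_gvPar_of_shapes_goodOrdHalf_periodFree`,
**`thm13_charIdeal_eq_of_gvPar_tateFree_periodFree`** (A14 from EIGHT registered facts: `hGV` p221999,
A115, A116, A195, Wuthrich Thm. 16, A226, A224, A225) and **`thm13_charIdeal_eq_of_gvPar_periodFree_of_datum`**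
(A115 replaced by the datum record T-GV23L, as in gen 26's `ClassClosureOfDatum`).

References: [GreenbergVatsal2000] Thm. (1.3), §2 p. 28, §3 Cor. (3.8), Thm. (3.11);
[DokchitserLocalInvariants2015] Prop. 16, Thm. 2; HOME/b2b-bsdres-eisenstein-p2/X2-GAP.md §33.
-/

set_option autoImplicit false

noncomputable section

open scoped Classical MatrixGroups ModularForm

open PowerSeries NumberField IsDedekindDomain Field WeierstrassCurve CongruenceSubgroup
  Literature.NumberTheory.EllipticCurves Literature.NumberTheory.EllipticCurves.GreenbergVatsal2000
  Literature.NumberTheory.EllipticCurves.ModularForms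
  Literature.NumberTheory.EllipticCurves.Rank1Residual
  Summit.BirchSwinnertonDyer.Rank1Residual.X2.IsogenyQuotientLine
  Summit.BirchSwinnertonDyer.Rank1Residual.X2.IsogenyLineTypeGoodOrdinary
  Summit.BirchSwinnertonDyer.Rank1Residual.X2.IsogenyLambdaInvariant
  Summit.BirchSwinnertonDyer.Rank1Residual.X2.GreenbergVatsalAnalyticTransferCore
  Summit.BirchSwinnertonDyer.Rank1Residual.X2.GreenbergVatsalCaseTwo
  Summit.BirchSwinnertonDyer.Rank1Residual.X2.GreenbergVatsalCaseOneGoodOrdinary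
  Summit.BirchSwinnertonDyer.Rank1Residual.X2.GreenbergVatsalThm13GoodOrdinary
  Summit.BirchSwinnertonDyer.Rank1Residual.X2.GreenbergVatsalThm13GoodOrdinaryTateFree
  Summit.BirchSwinnertonDyer.Rank1Residual.X2.EisensteinCongruenceOfFacts
  Summit.BirchSwinnertonDyer.Rank1Residual.X2.GreenbergProp510OfFacts
  Summit.BirchSwinnertonDyer.Rank1Residual.X2.NonPrimitiveLambdaInvariantOfDatum

namespace Summit.BirchSwinnertonDyer.Rank1Residual.X2.GreenbergVatsalThm13PeriodFree

variable {p : ℕ} [hp : Fact p.Prime]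

/-! ## §2. CASE 2 at a good ordinary prime, by the isogeny `E → E/Φ₀` -/

/-- **GV Thm. (1.3), CASE 2 (rational line UNRAMIFIED at `p` and ODD), at a GOOD ORDINARY prime —
`μ^{anal}_E = 0` and `λ^{anal}_E = λ^{alg}_E`** — gen 20's `caseTwo_clause_goodOrd` (GV p. 28
isogeny reduction `E → E/Φ₀`, kernel `λ`-invariance `lambdaInvariant_eq_of_isogeny`) with A61
weakened to its good-ordinary half `hG'` (gen 24) and — gen 28 — the period relation
`Ω_{E'} = u·Ω_E`, `|u|_p = 1` supplied by the kernel theorem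
`IsogenyPeriodRatio.exists_quot_realPeriodRat_eq_unit_mul` instead of the registered fact A180.
Proof verbatim otherwise.
[cite: GreenbergVatsal2000, Thm. (1.3), §2 p. 28, §3 Cor. (3.8)]
[cite: GreenbergLNM1716, Prop. 5.10 (PDF p. 147)] -/
theorem caseTwo_clause_goodOrdHalf_periodFree
    (hGV : imKummer_ge_greenbergCondition_at_p) (hA : lambda_nonPrimitive_eq_add_sum_delta)
    (hB : divisible_nonPrimitiveSelmerInfty_of_mu_eq_zero)
    (hG' : ∀ (W : WeierstrassCurve ℚ) [W.IsElliptic] [W.IsGloballyMinimal] (p : ℕ) [Fact p.Prime]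
      {κ : ZpExtension ℚ p} {γ : absoluteGaloisGroup ℚ},
      p ≠ 2 → W.HasGoodReductionAtPrime p → ¬ (p : ℤ) ∣ W.frobeniusTrace p → GVPar W p →
      κ.IsCyclotomic → κ.IsTopGenerator γ → ∀ D : W.SelmerDualData κ γ,
      D.IsTorsion ∧ ∃ g : IwasawaAlgebra p, D.charIdeal = Ideal.span {g} ∧ HasUnitContent g)
    (hLiftF : residualEpsilon_surjOn_of_lineRamifiedEven)
    (hAn : ∀ (W : WeierstrassCurve ℚ) [W.IsGloballyMinimal] [W.IsElliptic] (p : ℕ) [Fact p.Prime]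
      (κ : ZpExtension ℚ p) {N : ℕ} [NeZero N] (f : CuspForm (Gamma0 N) 2)
      (S₀ : Finset (HeightOneSpectrum (𝓞 ℚ)))
      (Φ₀ : AddSubgroup (W.geomTorsion (p : ℤ))) (hΦ : IsRationalLine W p Φ₀),
      p ≠ 2 → W.HasGoodReductionAtPrime p → ¬ (p : ℤ) ∣ W.frobeniusTrace p → κ.IsCyclotomic →
      ¬ LineUnramifiedAt W p Φ₀ → LineEven W p Φ₀ → IsNewformOf W f →
      (∀ v ∈ S₀, ((p : ℕ) : 𝓞 ℚ) ∉ v.asIdeal) →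
      (∀ v : HeightOneSpectrum (𝓞 ℚ), v ∉ S₀ → ((p : ℕ) : 𝓞 ℚ) ∉ v.asIdeal →
        W.HasGoodReductionAt v) →
      ∀ (ϖ : ℚ), (ϖ : ℝ) * W.realPeriodRat = plusPeriod f →
      ∀ (b : IwasawaAlgebra p),
        iwasawaToPowerSeries p b =
          PowerSeries.C ((ϖ : ℚ) : ℚ_[p]) * padicLFunction f (unitRoot W p : ℚ_[p]) →
        HasUnitContent (b * eulerFactorProduct W p S₀) ∧
          p ^ (PowerSeries.map (PadicInt.toZMod (p := p)) (b * eulerFactorProduct W p S₀)).order.toNat =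
            Nat.card (residualLineH1 W p κ S₀ Φ₀ hΦ) * Nat.card (residualQuotSelmer W p κ S₀ Φ₀ hΦ))
    (W : WeierstrassCurve ℚ) [W.IsElliptic] [W.IsGloballyMinimal] (p : ℕ) [Fact p.Prime]
    {κ : ZpExtension ℚ p} {γ : absoluteGaloisGroup ℚ} {N : ℕ} [NeZero N]
    {f : CuspForm (Gamma0 N) 2}
    (hp : p ≠ 2) (hgood : W.HasGoodReductionAtPrime p) (hord : ¬ (p : ℤ) ∣ W.frobeniusTrace p)
    {Φ₀ : AddSubgroup (W.geomTorsion (p : ℤ))} (hΦ : IsRationalLine W p Φ₀)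
    (hunr : LineUnramifiedAt W p Φ₀) (hodd : LineOdd W p Φ₀)
    (hκ : κ.IsCyclotomic) (hγ : κ.IsTopGenerator γ) (hf : IsNewformOf W f)
    (D : W.SelmerDualData κ γ) (ϖ : ℚ) (hϖ : (ϖ : ℝ) * W.realPeriodRat = plusPeriod f)
    (fE : IwasawaAlgebra p) (hchar : D.charIdeal = Ideal.span {fE}) :
    ∀ (b : IwasawaAlgebra p),
      iwasawaToPowerSeries p b =
        PowerSeries.C ((ϖ : ℚ) : ℚ_[p]) * padicLFunction f (unitRoot W p : ℚ_[p]) →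
      HasUnitContent b ∧
        (PowerSeries.map (PadicInt.toZMod (p := p)) b).order =
          (PowerSeries.map (PadicInt.toZMod (p := p)) fE).order := by
  intro b hιb
  -- the quotient `E' = E/Φ₀` on a globally minimal model, with its ramified-even line
  obtain ⟨W', _, _, g, hker, -, u, hu1, hΩ⟩ :=
    IsogenyPeriodRatio.exists_quot_realPeriodRat_eq_unit_mul hp (Or.inl ⟨hgood, hord⟩) hΦ hunr hodd
  obtain ⟨Φ', hΦ', hram', heven'⟩ :=
    exists_rationalLine_ramified_even_of_isogeny_goodOrd hp hgood hord hΦ hunr hodd g hker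
  have hiso : IsIsogenous W W' := ⟨g⟩
  have hgood' : W'.HasGoodReductionAtPrime p := hasGoodReductionAtPrime_of_isIsogenous hiso hgood
  have hord' : ¬ (p : ℤ) ∣ W'.frobeniusTrace p := not_dvd_frobeniusTrace_of_isIsogenous hiso hgood hord
  have hα : unitRoot W p = unitRoot W' p := unitRoot_eq_of_isIsogenous hiso hgood
  have hf' : IsNewformOf W' f := hf.of_isIsogenous hiso.symm_of_charZero
  have hgv : GVPar W p := ⟨Φ₀, hΦ, Or.inr ⟨hunr, hodd⟩⟩
  have hgv' : GVPar W' p := ⟨Φ', hΦ', Or.inl ⟨hram', heven'⟩⟩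
  rw [hα] at hιb
  -- the period: `Ω_{E'} = u · Ω_E`, `|u|_p = 1` (Cor. (3.8), DERIVED: `X2/IsogenyPeriodRatio`)
  have hu0 : (u : ℚ_[p]) ≠ 0 := fun h ↦ by simp [h] at hu1
  have hu0' : u ≠ 0 := fun h ↦ hu0 (by rw [h, Rat.cast_zero])
  set cU : ℤ_[p]ˣ := PadicInt.mkUnits hu1 with hcU
  have hcUinv : (((cU⁻¹ : ℤ_[p]ˣ) : ℤ_[p]) : ℚ_[p]) = (u : ℚ_[p])⁻¹ := by
    apply eq_inv_of_mul_eq_one_left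
    rw [← PadicInt.mkUnits_eq hu1, ← PadicInt.coe_mul, Units.inv_mul, PadicInt.coe_one]
  have hϖ' : ((ϖ / u : ℚ) : ℝ) * W'.realPeriodRat = plusPeriod f := by
    rw [hΩ, Rat.cast_div, ← hϖ, ← mul_assoc,
      div_mul_cancel₀ _ (by exact_mod_cast hu0' : (u : ℝ) ≠ 0)]
  -- a dual datum for `E'`; `μ = 0` on both sides (Prop. 5.10, good-ordinary half); `λ(E) = λ(E')`
  obtain ⟨D'⟩ := W'.nonempty_selmerDualData_holds κ γ hγ
  haveI := WeierstrassCurve.SelmerDualData.module_finite_of_isCyclotomic W κ hκ D hγ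
  haveI := WeierstrassCurve.SelmerDualData.module_finite_of_isCyclotomic W' κ hκ D' hγ
  obtain ⟨hX, fE₀, hchar₀, huf₀⟩ := hG' W p hp hgood hord hgv hκ hγ D
  obtain ⟨hX', fE', hchar', huf'⟩ := hG' W' p hp hgood' hord' hgv' hκ hγ D'
  have hμ : D.mu = 0 := (mu_eq_zero_iff_hasUnitContent D hX hchar₀).mpr huf₀
  have hμ' : D'.mu = 0 := (mu_eq_zero_iff_hasUnitContent D' hX' hchar').mpr huf'
  have hordfE : (PowerSeries.map (PadicInt.toZMod (p := p)) fE).order =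
      (PowerSeries.map (PadicInt.toZMod (p := p)) fE').order := by
    rw [← natCast_lambdaInvariant_eq_order_map_toZMod D hX hμ hchar,
      ← natCast_lambdaInvariant_eq_order_map_toZMod D' hX' hμ' hchar',
      lambdaInvariant_eq_of_isogeny g D D']
  -- CASE 1 for `E'`
  have hcl' := caseOne_clause_goodOrdHalf hGV hA hB hG' hLiftF hAn W' p hp hgood' hord' hΦ' hram'
    heven' hκ hγ hf' D' (ϖ / u) hϖ' fE' hchar'
  -- transport of `b`: `b' = C(c⁻¹)·b` has `ι b' = (ϖ/u)·L_p`, and `b = C(c)·b'`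
  have key : iwasawaToPowerSeries p (PowerSeries.C ((cU⁻¹ : ℤ_[p]ˣ) : ℤ_[p]) * b) =
        PowerSeries.C (((ϖ / u : ℚ)) : ℚ_[p]) * padicLFunction f (unitRoot W' p : ℚ_[p]) ∧
      b = PowerSeries.C ((cU : ℤ_[p]ˣ) : ℤ_[p]) * (PowerSeries.C ((cU⁻¹ : ℤ_[p]ˣ) : ℤ_[p]) * b) := by
    refine ⟨?_, ?_⟩
    · rw [iwasawaToPowerSeries_C_mul, hιb, ← mul_assoc, ← map_mul, Rat.cast_div, div_eq_inv_mul,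
        hcUinv]
    · rw [← mul_assoc, ← map_mul, Units.mul_inv, map_one, one_mul]
  obtain ⟨hιb', hb⟩ := key
  obtain ⟨hub', hord''⟩ := hcl' _ hιb'
  obtain ⟨hC1, hC2⟩ := hasUnitContent_and_order_C_mul cU
    (PowerSeries.C ((cU⁻¹ : ℤ_[p]ˣ) : ℤ_[p]) * b)
  refine ⟨?_, ?_⟩
  · rw [hb]; exact hC1.mpr hub'
  · rw [hb, hC2, hord'', hordfE]

/-! ## §3. Both cases -/

/-- **GV Thm. (1.3) at an odd GOOD ORDINARY prime under (GV) — `μ^{anal}_E = 0`,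
`λ^{anal}_E = λ^{alg}_E`** — gen 20's `lambda_muAnal_goodOrd_of_gvPar` with A61 weakened to its
good-ordinary half `hG'`; CASE 1 = `caseOne_clause_goodOrdHalf`, CASE 2 = `caseTwo_clause_goodOrdHalf_periodFree`.
[cite: GreenbergVatsal2000, Thm. (1.3) with §2 (16), p. 28 and §3 Thm. (3.11), Cor. (3.8)] -/
theorem lambda_muAnal_goodOrd_of_gvPar_goodOrdHalf_periodFree
    (hGV : imKummer_ge_greenbergCondition_at_p) (hA : lambda_nonPrimitive_eq_add_sum_delta)
    (hB : divisible_nonPrimitiveSelmerInfty_of_mu_eq_zero)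
    (hG' : ∀ (W : WeierstrassCurve ℚ) [W.IsElliptic] [W.IsGloballyMinimal] (p : ℕ) [Fact p.Prime]
      {κ : ZpExtension ℚ p} {γ : absoluteGaloisGroup ℚ},
      p ≠ 2 → W.HasGoodReductionAtPrime p → ¬ (p : ℤ) ∣ W.frobeniusTrace p → GVPar W p →
      κ.IsCyclotomic → κ.IsTopGenerator γ → ∀ D : W.SelmerDualData κ γ,
      D.IsTorsion ∧ ∃ g : IwasawaAlgebra p, D.charIdeal = Ideal.span {g} ∧ HasUnitContent g)
    (hLiftF : residualEpsilon_surjOn_of_lineRamifiedEven)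
    (hAn : ∀ (W : WeierstrassCurve ℚ) [W.IsGloballyMinimal] [W.IsElliptic] (p : ℕ) [Fact p.Prime]
      (κ : ZpExtension ℚ p) {N : ℕ} [NeZero N] (f : CuspForm (Gamma0 N) 2)
      (S₀ : Finset (HeightOneSpectrum (𝓞 ℚ)))
      (Φ₀ : AddSubgroup (W.geomTorsion (p : ℤ))) (hΦ : IsRationalLine W p Φ₀),
      p ≠ 2 → W.HasGoodReductionAtPrime p → ¬ (p : ℤ) ∣ W.frobeniusTrace p → κ.IsCyclotomic →
      ¬ LineUnramifiedAt W p Φ₀ → LineEven W p Φ₀ → IsNewformOf W f →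
      (∀ v ∈ S₀, ((p : ℕ) : 𝓞 ℚ) ∉ v.asIdeal) →
      (∀ v : HeightOneSpectrum (𝓞 ℚ), v ∉ S₀ → ((p : ℕ) : 𝓞 ℚ) ∉ v.asIdeal →
        W.HasGoodReductionAt v) →
      ∀ (ϖ : ℚ), (ϖ : ℝ) * W.realPeriodRat = plusPeriod f →
      ∀ (b : IwasawaAlgebra p),
        iwasawaToPowerSeries p b =
          PowerSeries.C ((ϖ : ℚ) : ℚ_[p]) * padicLFunction f (unitRoot W p : ℚ_[p]) →
        HasUnitContent (b * eulerFactorProduct W p S₀) ∧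
          p ^ (PowerSeries.map (PadicInt.toZMod (p := p)) (b * eulerFactorProduct W p S₀)).order.toNat =
            Nat.card (residualLineH1 W p κ S₀ Φ₀ hΦ) * Nat.card (residualQuotSelmer W p κ S₀ Φ₀ hΦ))
    (W : WeierstrassCurve ℚ) [W.IsElliptic] [W.IsGloballyMinimal] (p : ℕ) [Fact p.Prime]
    {κ : ZpExtension ℚ p} {γ : absoluteGaloisGroup ℚ} {N : ℕ} [NeZero N]
    {f : CuspForm (Gamma0 N) 2}
    (hp : p ≠ 2) (hgood : W.HasGoodReductionAtPrime p) (hord : ¬ (p : ℤ) ∣ W.frobeniusTrace p)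
    (hpar : GVPar W p) (hκ : κ.IsCyclotomic) (hγ : κ.IsTopGenerator γ) (hf : IsNewformOf W f)
    (D : W.SelmerDualData κ γ) (ϖ : ℚ) (hϖ : (ϖ : ℝ) * W.realPeriodRat = plusPeriod f)
    (fE : IwasawaAlgebra p) (hchar : D.charIdeal = Ideal.span {fE}) :
    ∀ (b : IwasawaAlgebra p),
      iwasawaToPowerSeries p b =
        PowerSeries.C ((ϖ : ℚ) : ℚ_[p]) * padicLFunction f (unitRoot W p : ℚ_[p]) →
      HasUnitContent b ∧
        (PowerSeries.map (PadicInt.toZMod (p := p)) b).order =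
          (PowerSeries.map (PadicInt.toZMod (p := p)) fE).order := by
  obtain ⟨Φ₀, hΦ, hcase⟩ := hpar
  rcases hcase with ⟨hram, heven⟩ | ⟨hunr, hodd⟩
  · exact caseOne_clause_goodOrdHalf hGV hA hB hG' hLiftF hAn W p hp hgood hord hΦ hram heven hκ hγ
      hf D ϖ hϖ fE hchar
  · exact caseTwo_clause_goodOrdHalf_periodFree hGV hA hB hG' hLiftF hAn W p hp hgood hord hΦ hunr hodd hκ
      hγ hf D ϖ hϖ fE hchar

/-! ## §4. A14 from the good-ordinary half of Prop. 5.10 and the displayed analytic shape -/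

/-- (GV) gives a rational line, hence `E[p]` is reducible (Wuthrich Thm. 16's hypothesis). -/
private theorem not_irr_of_gvPar_pf {W : WeierstrassCurve ℚ} [W.IsElliptic] {p : ℕ} [Fact p.Prime]
    (hpar : GVPar W p) : ¬ W.HasIrreducibleModPGaloisRep p := by
  obtain ⟨Φ, hΦ, -⟩ := hpar
  exact not_hasIrreducibleModPGaloisRep_of_isRationalLine hΦ

/-- **`GreenbergVatsal2000.thm13_charIdeal_eq_of_gvPar` DERIVED from the shapes** — gen 20's
`thm13_charIdeal_eq_of_gvPar_of_shapes` with A61 weakened to its good-ordinary half `hG'`: Wuthrich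
Thm. 16 (`hW16`: `ϖ·L_p = ι g`, `g ∈ char_Λ X`), `μ(g) = 0` and `ord_T(g mod p) = ord_T(f_E mod p)`
(§3), so `g = c·f_E` with `c ∈ Λˣ` (GV p. 20) and `char_Λ X = (g)`.
[cite: GreenbergVatsal2000, Thm. (1.3), Thm. (1.2) and p. 20; §2 (16), p. 28; §3 Thm. (3.11), (28), p. 43, Cor. (3.8)]
[cite: Wuthrich2014, Thm. 16 (p. 397)] [cite: GreenbergLNM1716, Prop. 5.10 (PDF p. 147)] -/
theorem thm13_charIdeal_eq_of_gvPar_of_shapes_goodOrdHalf_periodFree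
    (hGV : imKummer_ge_greenbergCondition_at_p) (hA : lambda_nonPrimitive_eq_add_sum_delta)
    (hB : divisible_nonPrimitiveSelmerInfty_of_mu_eq_zero)
    (hG' : ∀ (W : WeierstrassCurve ℚ) [W.IsElliptic] [W.IsGloballyMinimal] (p : ℕ) [Fact p.Prime]
      {κ : ZpExtension ℚ p} {γ : absoluteGaloisGroup ℚ},
      p ≠ 2 → W.HasGoodReductionAtPrime p → ¬ (p : ℤ) ∣ W.frobeniusTrace p → GVPar W p →
      κ.IsCyclotomic → κ.IsTopGenerator γ → ∀ D : W.SelmerDualData κ γ,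
      D.IsTorsion ∧ ∃ g : IwasawaAlgebra p, D.charIdeal = Ideal.span {g} ∧ HasUnitContent g)
    (hLiftF : residualEpsilon_surjOn_of_lineRamifiedEven)
    (hAn : ∀ (W : WeierstrassCurve ℚ) [W.IsGloballyMinimal] [W.IsElliptic] (p : ℕ) [Fact p.Prime]
      (κ : ZpExtension ℚ p) {N : ℕ} [NeZero N] (f : CuspForm (Gamma0 N) 2)
      (S₀ : Finset (HeightOneSpectrum (𝓞 ℚ)))
      (Φ₀ : AddSubgroup (W.geomTorsion (p : ℤ))) (hΦ : IsRationalLine W p Φ₀),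
      p ≠ 2 → W.HasGoodReductionAtPrime p → ¬ (p : ℤ) ∣ W.frobeniusTrace p → κ.IsCyclotomic →
      ¬ LineUnramifiedAt W p Φ₀ → LineEven W p Φ₀ → IsNewformOf W f →
      (∀ v ∈ S₀, ((p : ℕ) : 𝓞 ℚ) ∉ v.asIdeal) →
      (∀ v : HeightOneSpectrum (𝓞 ℚ), v ∉ S₀ → ((p : ℕ) : 𝓞 ℚ) ∉ v.asIdeal →
        W.HasGoodReductionAt v) →
      ∀ (ϖ : ℚ), (ϖ : ℝ) * W.realPeriodRat = plusPeriod f →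
      ∀ (b : IwasawaAlgebra p),
        iwasawaToPowerSeries p b =
          PowerSeries.C ((ϖ : ℚ) : ℚ_[p]) * padicLFunction f (unitRoot W p : ℚ_[p]) →
        HasUnitContent (b * eulerFactorProduct W p S₀) ∧
          p ^ (PowerSeries.map (PadicInt.toZMod (p := p)) (b * eulerFactorProduct W p S₀)).order.toNat =
            Nat.card (residualLineH1 W p κ S₀ Φ₀ hΦ) * Nat.card (residualQuotSelmer W p κ S₀ Φ₀ hΦ))
    (hW16 : Wuthrich2014.charIdeal_dvd_padicLFunction) :
    thm13_charIdeal_eq_of_gvPar := by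
  intro W _ _ p _ hp hgood hord hpar κ γ hκ hγ hγ' _ f hf ϖ hϖ D
  -- good-ordinary half of Greenberg Prop. 5.10: torsion, `char X = (f_E)` with `μ(f_E) = 0`
  obtain ⟨hX, fE, hchar, -⟩ := hG' W p hp hgood hord hpar hκ hγ D
  -- Wuthrich Thm. 16 (Kato made integral): `ϖ·L_p = ι g`, `g ∈ char X`
  obtain ⟨-, g, hg, hιg⟩ := hW16 W p hp ((isOrdinaryAt_iff W p).mpr ⟨hgood, hord⟩)
    (not_irr_of_gvPar_pf hpar) hκ hγ hγ' hf D ϖ hϖ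
  -- GV Thm. (1.3): `μ(g) = 0`, `ord_T(g mod p) = ord_T(f_E mod p)`
  obtain ⟨hug, hordg⟩ := lambda_muAnal_goodOrd_of_gvPar_goodOrdHalf_periodFree hGV hA hB hG' hLiftF hAn W p hp
    hgood hord hpar hκ hγ hf D ϖ hϖ fE hchar g hιg
  -- GV p. 20: `g = c·f_E` with `c` a unit, so `char X = (g)`
  rw [hchar] at hg
  obtain ⟨c, hc⟩ := Ideal.mem_span_singleton'.mp hg
  have hcu : IsUnit c := isUnit_of_mul_eq_of_order_map_eq ((mul_comm fE c).trans hc) hug hordg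
  refine ⟨hX, g, ?_, hιg⟩
  rw [hchar, ← hc, Ideal.span_singleton_mul_left_unit hcu]

/-! ## §5. A14 from NINE registered facts, none about Tate curves -/

/-- **A14 = `GreenbergVatsal2000.thm13_charIdeal_eq_of_gvPar` (GV Thm. (1.3) with Kato's Thm. (1.2):
Mazur's main conjecture `char_Λ X(E/ℚ_∞) = (L(E/ℚ,T))` at an odd GOOD ORDINARY Eisenstein prime under
(GV)) FROM EIGHT REGISTERED FACTS, NONE OF THEM ABOUT TATE CURVES, AND NO PERIOD FACT** (gen 28: A180 derived): `hGV` (p221999, Greenberg LNM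
1716 Props. 2.2–2.4 / GV p. 26), `hA` (A115, GV (6)–(7)), `hB` (A116, GV Prop. (2.5)), `hLiftF`
(A195, GV p. 28/30), `hW16` (Wuthrich 2014 Thm. 16), `h311` (F1, GV Thm.
(3.11) + (28)), `hC`/`hD` (F2/F3, Ferrero–Washington + Mazur–Wiles character identities). The
good-ordinary half of Greenberg's Prop. 5.10 is gen 22's `prop510_goodOrd_of_facts` (F0/F2/F3, no
Tate fact), the displayed analytic hypothesis is gen 21's
`nonPrimitive_unitContent_and_lambda_eq_residual_of_lineRamifiedEven_goodOrd_of_facts` (F0/F1/F2/F3),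
and F0 (Kubota–Leopoldt existence) is gen 23's theorem `exists_characterLFunction_holds`. Compare gen
22's `thm13_charIdeal_eq_of_gvPar_of_derivedFacts` (same statement, two Tate binders more).
[cite: GreenbergVatsal2000, Thm. (1.3), Thm. (1.2), p. 20; §2 (16), pp. 26–30; §3 Thm. (3.11), (28), pp. 41–43, Cor. (3.8)]
[cite: Wuthrich2014, Thm. 16 (p. 397)] [cite: GreenbergLNM1716, Prop. 5.10 (PDF pp. 147–148), Props. 2.2–2.4]
[cite: LangCyclotomic1990, Ch. 4 §3 Thm. 3.2] -/
theorem thm13_charIdeal_eq_of_gvPar_tateFree_periodFree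
    (hGV : imKummer_ge_greenbergCondition_at_p) (hA : lambda_nonPrimitive_eq_add_sum_delta)
    (hB : divisible_nonPrimitiveSelmerInfty_of_mu_eq_zero)
    (hLiftF : residualEpsilon_surjOn_of_lineRamifiedEven)
    (hW16 : Wuthrich2014.charIdeal_dvd_padicLFunction)
    (h311 : thm311_hasUnitContent_iff_and_order_eq_of_lineRamifiedEven)
    (hC : characterLFunctionC_hasUnitContent_and_order_eq_card)
    (hD : characterLFunctionD_hasUnitContent_and_order_eq_card) :
    thm13_charIdeal_eq_of_gvPar :=
  thm13_charIdeal_eq_of_gvPar_of_shapes_goodOrdHalf_periodFree hGV hA hB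
    (fun W _ _ p _ _ _ hp hgood hord hpar hκ hγ D ↦
      prop510_goodOrd_of_facts W p _ exists_characterLFunction_holds hC hD hp hgood hord hpar hκ hγ D)
    hLiftF
    (fun W _ _ p _ κ _ _ f S₀ Φ₀ hΦ hp hgood hord hκ hram heven hf hS₀ hS ↦
      nonPrimitive_unitContent_and_lambda_eq_residual_of_lineRamifiedEven_goodOrd_of_facts
        exists_characterLFunction_holds h311 hC hD W p κ f S₀ Φ₀ hΦ hp hgood hord hκ hram heven hf hS₀ hS)
    hW16


/-! ## §6. A14 with A115 replaced by the datum record -/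

/-- **A14 from EIGHT registered facts with A115 fed from the datum record T-GV23L** (gen 26's
`ClassClosureOfDatum.thm13_charIdeal_eq_of_gvPar_tateFree_of_datum` minus `hP`): A14 ⇐ {`hGV`
p221999, T-GV23L, A116, A195, Wuthrich Thm 16, A226, A224, A225}. Bookkeeping.
[cite: GreenbergVatsal2000, Thm. (1.3); §1 (6)–(7); §2 Cor. (2.3), Prop. (2.4), p. 26; §3 Thm. (3.11)]
[cite: Wuthrich2014, Thm. 16 (p. 397)] -/
theorem thm13_charIdeal_eq_of_gvPar_periodFree_of_datum
    (hGV : imKummer_ge_greenbergCondition_at_p) (h23 : datumSelmer_nonPrimitive_invariants)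
    (hB : divisible_nonPrimitiveSelmerInfty_of_mu_eq_zero)
    (hLiftF : residualEpsilon_surjOn_of_lineRamifiedEven)
    (hW16 : Wuthrich2014.charIdeal_dvd_padicLFunction)
    (h311 : thm311_hasUnitContent_iff_and_order_eq_of_lineRamifiedEven)
    (hC : characterLFunctionC_hasUnitContent_and_order_eq_card)
    (hD : characterLFunctionD_hasUnitContent_and_order_eq_card) :
    thm13_charIdeal_eq_of_gvPar :=
  thm13_charIdeal_eq_of_gvPar_tateFree_periodFree hGV
    (NonPrimitiveLambdaInvariantOfDatum.lambda_nonPrimitive_eq_add_sum_delta_of_datum h23 hGV) hB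
    hLiftF hW16 h311 hC hD

end Summit.BirchSwinnertonDyer.Rank1Residual.X2.GreenbergVatsalThm13PeriodFree

end
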